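import Mathlib
import HarnessLib
import Literature.Computability.AlgebraicComplexity.PatternExpressions
import Summits.ValiantsHypothesis.ValiantsHypothesis.Theorems.MonotoneRestorationMonotoneRestorationQPLinearWidthDefs
import Summits.ValiantsHypothesis.ValiantsHypothesis.Theorems.MonotoneRestorationMonotoneRestorationQPLinearWidthIsolationAnyLevel

/-!
# Route MonotoneRestoration, crux `MonotoneRestorationQP` (stmt-15886), line `linear_width` —
# THE SMALL-WITNESS RUNG: degree `≤ N / g(polylog N)` modulo small-witness distinguishing closedness (W1)

Helper file (`--supports stmt-ValiantsHypothesis-15886`), def-free.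

The census KRONECKER-MONOTONICITY-g11.md located a reachable rung strictly between the proved floor `θ₀` (polylog
degree, `widthRung_polylogDegree`) and the open rung `θ₁` (`stub_linearDegreeWidthRestoration`, linear degree): degree
`≤ N/polylog N`, conditional on ONE input, the SMALL-WITNESS weighted homomorphism-distinguishing closedness

  (W1)_g : every bipartite pattern without isolated vertices of treewidth `≥ g(k)` is distinguished by a pair of points
           of `ℂ^{g(k)×g(k)}` that are hom-indistinguishable below treewidth `k`,

for a polynomially bounded `g` (in print for simple hosts via polynomial grid minors + CFI over the grid + oddomorphism
transfer: Chekuri–Chuzhoy; Roberson 2022; Dawar–Pago–Seppelt 2025 Thm 7.3, Lem 7.4–7.7 — NOT in the tree; here a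
HYPOTHESIS, stated inline).  With the factorisation-free conditional rung
`IsolationAnyLevel.qpOrbit_of_matrixSymmetric_of_smallDistinguishable₂` (p840920) this file closes that rung in kernel
form:

* `exists_polylog_dominates` — bookkeeping: `((L + c₀)^c₀ + 2)^e ≤ (L + c')^{c'}` for one `c'` and all `L`;
* `qpOrbitSymm_of_smallWitness` — **THE SMALL-WITNESS RUNG**: under (W1)_g with `g k ≤ (k+2)^e`, every MATRIX-SYMMETRIC
  family `f` determined at width `(log₂ N + c₀)^c₀` at every level (the node `PolylogHomDetermined`, with its constant
  made explicit) and of degree `deg f_N ≤ N / g((log₂ N + c₀)^c₀)` has square-symmetric circuits of quasi-polynomial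
  ORBIT size (`QPOrbitSymm f` of the line, verbatim).  `IsVPFamily` is idle; the degree budget is `N` over a
  polylogarithm depending on `f`'s width constant — so this is a rung of the graded family `WidthRung` for every
  degree budget `d(N) ≤ N/(log N)^{ω(1)}` (e.g. `N^{1-ε}`), but NOT `θ₁`: at linear degree no `ν ≥ 1` is admissible and
  what is left is the (GIANT) residue (near-spanning components), as recorded on the item.

Honest label: a conditional rung (the distinguishability input is a hypothesis, not a tree theorem); no stub closed; the
rung `θ₁`, the cruxes and VP ≠ VNP are NOT moved.
[cite: DawarPagoSeppelt2025, Thm 7.3, Thm 7.9, §7.1.1; DawarWilsenach2025, §3.3; DwivediPagoSeppelt2026, Lemma 8.18]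
-/

set_option linter.dupNamespace false

noncomputable section

open scoped Classical

namespace Summit.ValiantsHypothesis.ValiantsHypothesis.Theorems.SmallWitnessRung

open MvPolynomial Finset
open Literature.Computability.AlgebraicComplexity
open Summit.ValiantsHypothesis.ValiantsHypothesis.Theorems.MonotoneRestorationQPLinearWidth
open Summit.ValiantsHypothesis.ValiantsHypothesis.Theorems.IsolationAnyLevel

/-- Bookkeeping: a polynomial of a polylogarithm is dominated by one polylogarithm, uniformly in the logarithm `L`:
`((L + c₀)^c₀ + 2)^e ≤ (L + c')^{c'}` for `c' = (c₀ + 2)·(e + 1)`. [folklore] -/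
theorem exists_polylog_dominates (c₀ e : ℕ) : ∃ c' : ℕ, ∀ L : ℕ, ((L + c₀) ^ c₀ + 2) ^ e ≤ (L + c') ^ c' := by
  refine ⟨(c₀ + 2) * (e + 1), fun L => ?_⟩
  have ha : 1 ≤ (L + c₀ + 2) ^ c₀ := Nat.one_le_pow _ _ (by omega)
  have hb : 4 ≤ (L + c₀ + 2) ^ 2 := by
    calc 4 = 2 ^ 2 := by norm_num
      _ ≤ (L + c₀ + 2) ^ 2 := Nat.pow_le_pow_left (by omega) 2
  have h1 : (L + c₀) ^ c₀ + 2 ≤ (L + c₀ + 2) ^ (c₀ + 2) := by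
    calc (L + c₀) ^ c₀ + 2 ≤ (L + c₀ + 2) ^ c₀ + 2 :=
          Nat.add_le_add_right (Nat.pow_le_pow_left (by omega) _) 2
      _ ≤ (L + c₀ + 2) ^ c₀ * (L + c₀ + 2) ^ 2 := by nlinarith [ha, hb]
      _ = (L + c₀ + 2) ^ (c₀ + 2) := (pow_add _ _ _).symm
  calc ((L + c₀) ^ c₀ + 2) ^ e ≤ ((L + c₀ + 2) ^ (c₀ + 2)) ^ e := Nat.pow_le_pow_left h1 e
    _ = (L + c₀ + 2) ^ ((c₀ + 2) * e) := (pow_mul _ _ _).symm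
    _ ≤ (L + (c₀ + 2) * (e + 1)) ^ ((c₀ + 2) * e) := Nat.pow_le_pow_left (by nlinarith) _
    _ ≤ (L + (c₀ + 2) * (e + 1)) ^ ((c₀ + 2) * (e + 1)) :=
        Nat.pow_le_pow_right (by nlinarith) (Nat.mul_le_mul_left _ (Nat.le_succ e))

/-- **THE SMALL-WITNESS RUNG (weighted currency, factorisation-free).**  Assume the small-witness homomorphism-
distinguishing closedness (W1)_g: for every width `k`, every bipartite pattern without isolated vertices whose pattern
graph has treewidth `≥ g k` is distinguished — its homomorphism polynomial takes different values — by two points of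
`ℂ^{g(k)×g(k)}` that are hom-indistinguishable below treewidth `k`; and assume `g k ≤ (k+2)^e`.  Then every
matrix-symmetric family `f` whose values at every level `N` are determined by `HomIndist N ((log₂ N + c₀)^c₀)` and whose
degrees satisfy `deg f_N · g((log₂ N + c₀)^c₀) ≤ N` has square-symmetric circuits of quasi-polynomial orbit size
(`QPOrbitSymm f`).  Mechanism: the non-isomorphic admissible expansion of `f_N` (bridge), Kronecker isolation at level
`ν = g((log₂ N + c₀)^c₀) ≤ N / deg f_N` (no factorisation of `N`), (W1)_g kills every pattern of treewidth
`≥ (log₂ N + c')^{c'} ≥ g((log₂ N + c₀)^c₀)`, and the surviving narrow expansion is compiled by K2/K3.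
[cite: DawarPagoSeppelt2025, Thm 7.3, Thm 7.9, §7.1.1; DawarWilsenach2025, §3.3] -/
theorem qpOrbitSymm_of_smallWitness (g : ℕ → ℕ) (e : ℕ) (hg : ∀ k, g k ≤ (k + 2) ^ e)
    (hW1 : ∀ (k a b : ℕ) (E : Multiset (Fin a × Fin b)),
      (∀ u : Fin a, ∃ x ∈ E, x.1 = u) → (∀ v : Fin b, ∃ x ∈ E, x.2 = v) →
      g k ≤ Literature.Combinatorics.SimpleGraph.treewidth (patternGraph E) →
      ∃ z z' : Fin (g k) × Fin (g k) → ℂ, HomIndist (g k) k z z' ∧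
        eval z (homPoly E (g k) ℂ) ≠ eval z' (homPoly E (g k) ℂ))
    (f : (n : ℕ) → MvPolynomial (Fin n × Fin n) ℂ) (hsym : IsMatrixSymmetric f) (c₀ : ℕ)
    (hdet : ∀ (n : ℕ) (A B : Fin n × Fin n → ℂ), HomIndist n ((Nat.log 2 n + c₀) ^ c₀) A B →
      eval A (f n) = eval B (f n))
    (hdeg : ∀ n : ℕ, (f n).totalDegree * g ((Nat.log 2 n + c₀) ^ c₀) ≤ n) :
    QPOrbitSymm f := by
  obtain ⟨c', hc'⟩ := exists_polylog_dominates c₀ e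
  refine ⟨c' + 3, fun N => qpOrbit_of_matrixSymmetric_of_smallDistinguishable₂ f c₀ c' hsym hdet (fun n => ?_) N⟩
  refine ⟨g ((Nat.log 2 n + c₀) ^ c₀), hdeg n, fun a b E _ _ hrow hcol htw => ?_⟩
  refine hW1 _ a b E hrow hcol (le_trans ?_ htw)
  exact (hg _).trans (hc' (Nat.log 2 n))

/-- **The small-witness rung on the line's node `PolylogHomDetermined`** (same statement, the width constant of `f`
packaged existentially together with the matching degree budget). [cite: DawarPagoSeppelt2025, Thm 7.9, §7.1.1] -/
theorem qpOrbitSymm_of_smallWitness' (g : ℕ → ℕ) (e : ℕ) (hg : ∀ k, g k ≤ (k + 2) ^ e)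
    (hW1 : ∀ (k a b : ℕ) (E : Multiset (Fin a × Fin b)),
      (∀ u : Fin a, ∃ x ∈ E, x.1 = u) → (∀ v : Fin b, ∃ x ∈ E, x.2 = v) →
      g k ≤ Literature.Combinatorics.SimpleGraph.treewidth (patternGraph E) →
      ∃ z z' : Fin (g k) × Fin (g k) → ℂ, HomIndist (g k) k z z' ∧
        eval z (homPoly E (g k) ℂ) ≠ eval z' (homPoly E (g k) ℂ))
    (f : (n : ℕ) → MvPolynomial (Fin n × Fin n) ℂ) (hsym : IsMatrixSymmetric f)
    (hf : ∃ c₀ : ℕ, (∀ (n : ℕ) (A B : Fin n × Fin n → ℂ), HomIndist n ((Nat.log 2 n + c₀) ^ c₀) A B →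
        eval A (f n) = eval B (f n)) ∧ ∀ n : ℕ, (f n).totalDegree * g ((Nat.log 2 n + c₀) ^ c₀) ≤ n) :
    QPOrbitSymm f := by
  obtain ⟨c₀, hdet, hdeg⟩ := hf
  exact qpOrbitSymm_of_smallWitness g e hg hW1 f hsym c₀ hdet hdeg

end Summit.ValiantsHypothesis.ValiantsHypothesis.Theorems.SmallWitnessRung

end
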